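import Summits.Ventures.QEC.Thresholds.BBDepolarizingCensus
import Summits.Ventures.QEC.Census.BB.A1s_n144_k16_cce5fef4.Distance
import HarnessLib

/-!
# Depolarizing logical-error bounds for the census A.1 KERNEL-std bivariate-bicycle row `[[144,16,8]]`
# (qec-search-10 δ rows, `hasParams`) — UNCONDITIONAL, kernel

Venture QEC, `Summits/Ventures/QEC/Thresholds/` (LADDER-QEC rung Q5 × Q1 cell A.1, PARTITION row 09 "depolarising"; qec-type-09
gen 5; on-call instantiation lane of qec-lead block 19 (1) / R29 (6e); continues `BBDepolarizingCensusA1e.lean`). Each census row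
`Summit.Ventures.QEC.Census.<id>.hasParams : BB.HasParams <id>.code n k d` (KERNEL-std Brouwer–Zimmermann certificates,
`Census/BB/<id>/Distance.lean`) is fed to the generic census interface `bb_depolarizingFailureProb_le_of_hasParams`
(`BBDepolarizingCensus.lean`: sector-wise minimum-weight decoding under i.i.d. depolarizing noise of rate `p`; both marginals
independent flips of rate `q = 2p/3`), after checking the printed side condition `IsBBPoly` (three distinct pure powers in `A`
and in `B`) for the row's polynomials. Per row: `isBBPoly_<id>`, `<id>_depolarizingFailureProb_le`
(`P ≤ 2·(n(10√(q(1-q)))^d/(5(1-10√(q(1-q)))))`) and the polynomial form `<id>_depolarizingFailureProb_le_poly`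
(`100q(1-q) ≤ 1/4 ⇒ P ≤ (4n/5)·(100q(1-q))^{d/2}`). NB: bivariate-bicycle sectors are NOT graphlike (every qubit meets three checks of
each type), so the matching theorem of `MatchingDecoders.lean` does not apply to them; the decoder class here is minimum-weight
decoding (e.g. exhaustive or integer-programming decoding), sector by sector.

| row | `(ℓ, m)`, `A`, `B` | `[[n,k,d]]` | poly bound |
|---|---|---|---|
| `A1s_n144_k16_cce5fef4` | `(3,24)`, `1 + y² + y¹⁰`, `y¹⁸ + x + x²` | `[[144,16,8]]` | `115.2·u⁴` |

(`u = 100q(1-q)`, `q = 2p/3`). HONEST FRAMING: rigorous UPPER bounds on failure (union bounds), kernel axioms, no named fact, no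
`native_decide`; sector-wise (correlation-blind) minimum-weight decoding; not Monte Carlo numbers; the printed/MC pseudo-thresholds
of these codes are not claimed.

## References

* [DumerKovalevPryadko2015] I. Dumer, A. A. Kovalev, L. P. Pryadko, PRL 115 (2015) 050502, Thm 2, eq. (succesful-decoding-depolarizing).
* [BravyiEtAl2024] S. Bravyi et al., Nature 627 (2024) 778, §4 (the side condition: A, B sums of three distinct monomials).
-/

noncomputable section

namespace Summit.Ventures.QEC.Thresholds

open Finset Matrix
open Literature.InformationTheory.QuantumCodes
open Summit.Ventures.QEC.BB Summit.Ventures.QEC.Census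

/-- The polynomial form of the depolarizing bound: `100q(1-q) ≤ 1/4 ⇒` tail factor `≤ 2` and `(10√(q(1-q)))^{2j} = u^j`.
[folklore] -/
private theorem depol_poly_form_c {q N : ℝ} {j : ℕ} (hq0 : 0 ≤ q) (hq1 : q ≤ 1) (hN : 0 ≤ N)
    (hsmall : 100 * (q * (1 - q)) ≤ 1 / 4) :
    2 * (N * (10 * Real.sqrt (q * (1 - q))) ^ (2 * j) / (5 * (1 - 10 * Real.sqrt (q * (1 - q))))) ≤
      4 * N / 5 * (100 * (q * (1 - q))) ^ j := by
  have hqq : 0 ≤ q * (1 - q) := mul_nonneg hq0 (by linarith)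
  have hpow : (10 * Real.sqrt (q * (1 - q))) ^ (2 * j) = (100 * (q * (1 - q))) ^ j := by
    rw [pow_mul, mul_pow, Real.sq_sqrt hqq]
    norm_num
  have hs : 10 * Real.sqrt (q * (1 - q)) ≤ 1 / 2 := by
    have h1 : Real.sqrt (q * (1 - q)) ≤ Real.sqrt (1 / 400) := Real.sqrt_le_sqrt (by linarith)
    have h2 : Real.sqrt (1 / 400) = 1 / 20 := by
      rw [show (1 / 400 : ℝ) = (1 / 20) ^ 2 by norm_num, Real.sqrt_sq (by norm_num)]
    linarith
  rw [hpow]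
  have hu : 0 ≤ N * (100 * (q * (1 - q))) ^ j := mul_nonneg hN (pow_nonneg (by positivity) j)
  have hden : (5 : ℝ) / 2 ≤ 5 * (1 - 10 * Real.sqrt (q * (1 - q))) := by linarith
  have hdiv : N * (100 * (q * (1 - q))) ^ j / (5 * (1 - 10 * Real.sqrt (q * (1 - q)))) ≤
      N * (100 * (q * (1 - q))) ^ j / (5 / 2) :=
    div_le_div_of_nonneg_left hu (by norm_num) hden
  have : N * (100 * (q * (1 - q))) ^ j / (5 / 2) = 2 * N / 5 * (100 * (q * (1 - q))) ^ j := by ring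
  linarith

/-! ### `A1s_n144_k16_cce5fef4 = [[144, 16, 8]]` on `ℤ3 × ℤ24` -/

/-- `A = 1 + y² + y¹⁰` (`1 = x⁰`), `B = y¹⁸ + x + x²` are sums of three distinct pure powers. [cite: BravyiEtAl2024, §4 (arXiv:2308.07915 chunk p0009 L20–24)] -/
theorem isBBPoly_A1s_n144_k16 : BB.IsBBPoly A1s_n144_k16_cce5fef4.code.A ∧ BB.IsBBPoly A1s_n144_k16_cce5fef4.code.B :=
  ⟨⟨(Fin.ofNat 3 0, 0), (0, Fin.ofNat 24 2), (0, Fin.ofNat 24 10), by decide, by decide, by decide,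
      ⟨Or.inr rfl, Or.inl rfl, Or.inl rfl⟩, rfl⟩,
    ⟨(0, Fin.ofNat 24 18), (Fin.ofNat 3 1, 0), (Fin.ofNat 3 2, 0), by decide, by decide, by decide,
      ⟨Or.inl rfl, Or.inr rfl, Or.inr rfl⟩, rfl⟩⟩

/-- **`[[144,16,8]]` (row `A1s_n144_k16_cce5fef4`) under depolarizing noise**, sector-wise minimum-weight decoding:
`P^depol(p) ≤ 2·(144(10√(q(1-q)))^8/(5(1-10√(q(1-q)))))`, `q = 2p/3`. UNCONDITIONAL, kernel.
[cite: DumerKovalevPryadko2015, Thm 2 (w = 6) with eq. (succesful-decoding-depolarizing)] -/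
theorem A1s_n144_k16_depolarizingFailureProb_le
    {DX DZ : Decoder (BB.Mono 3 24 → ZMod 2) (BB.Mono 3 24 ⊕ BB.Mono 3 24 → ZMod 2)}
    (hDX : DX.IsMinWeight A1s_n144_k16_cce5fef4.code.css.xSyndrome
      (A1s_n144_k16_cce5fef4.code.css.kerZ : Set (BB.Mono 3 24 ⊕ BB.Mono 3 24 → ZMod 2)) hammingNorm)
    (hDZ : DZ.IsMinWeight A1s_n144_k16_cce5fef4.code.css.zSyndrome
      (A1s_n144_k16_cce5fef4.code.css.kerX : Set (BB.Mono 3 24 ⊕ BB.Mono 3 24 → ZMod 2)) hammingNorm)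
    {p : ℝ} (hp0 : 0 ≤ p) (hp : p ≤ 3 / 4) (hr : 10 * Real.sqrt (2 * p / 3 * (1 - 2 * p / 3)) < 1) :
    A1s_n144_k16_cce5fef4.code.css.depolarizingFailureProb DX DZ p ≤
      2 * ((144 : ℕ) * (10 * Real.sqrt (2 * p / 3 * (1 - 2 * p / 3))) ^ 8 /
        (5 * (1 - 10 * Real.sqrt (2 * p / 3 * (1 - 2 * p / 3))))) :=
  bb_depolarizingFailureProb_le_of_hasParams _ isBBPoly_A1s_n144_k16.1 isBBPoly_A1s_n144_k16.2
    A1s_n144_k16_cce5fef4.hasParams (by norm_num) hDX hDZ hp0 hp hr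

/-- **`[[144,16,8]]`, polynomial form**: `100q(1-q) ≤ 1/4 ⇒ P^depol(p) ≤ 115.2·(100q(1-q))^4`, `q = 2p/3`. UNCONDITIONAL.
[cite: DumerKovalevPryadko2015, Thm 2 (w = 6)] -/
theorem A1s_n144_k16_depolarizingFailureProb_le_poly
    {DX DZ : Decoder (BB.Mono 3 24 → ZMod 2) (BB.Mono 3 24 ⊕ BB.Mono 3 24 → ZMod 2)}
    (hDX : DX.IsMinWeight A1s_n144_k16_cce5fef4.code.css.xSyndrome
      (A1s_n144_k16_cce5fef4.code.css.kerZ : Set (BB.Mono 3 24 ⊕ BB.Mono 3 24 → ZMod 2)) hammingNorm)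
    (hDZ : DZ.IsMinWeight A1s_n144_k16_cce5fef4.code.css.zSyndrome
      (A1s_n144_k16_cce5fef4.code.css.kerX : Set (BB.Mono 3 24 ⊕ BB.Mono 3 24 → ZMod 2)) hammingNorm)
    {p : ℝ} (hp0 : 0 ≤ p) (hp : p ≤ 3 / 4) (hsmall : 100 * (2 * p / 3 * (1 - 2 * p / 3)) ≤ 1 / 4) :
    A1s_n144_k16_cce5fef4.code.css.depolarizingFailureProb DX DZ p ≤
      115.2 * (100 * (2 * p / 3 * (1 - 2 * p / 3))) ^ 4 := by
  have h := A1s_n144_k16_depolarizingFailureProb_le hDX hDZ hp0 hp (by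
    have h1 : Real.sqrt (2 * p / 3 * (1 - 2 * p / 3)) ≤ Real.sqrt (1 / 400) := Real.sqrt_le_sqrt (by linarith)
    have h2 : Real.sqrt (1 / 400) = 1 / 20 := by
      rw [show (1 / 400 : ℝ) = (1 / 20) ^ 2 by norm_num, Real.sqrt_sq (by norm_num)]
    linarith)
  have hpoly := depol_poly_form_c (q := 2 * p / 3) (N := (144 : ℕ)) (j := 4) (by positivity) (by linarith)
    (by positivity) hsmall
  rw [show 2 * 4 = 8 by norm_num] at hpoly
  refine h.trans (hpoly.trans (le_of_eq ?_))
  norm_num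

end Summit.Ventures.QEC.Thresholds

end
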